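import Summits.QuantumFields.YangMills.Theorems.FluctuationComparisonRegPrIntLS2BetaCovariantOscillationLinAvgStep
import Summits.QuantumFields.YangMills.Theorems.FluctuationComparisonRegPrIntLS2BetaCovariantOscillationCornerBox
import HarnessLib

/-!
# S2β · (REG-UP) FILE B — «THE TOWER TRANSPORT OF THE COVARIANT OSCILLATION»: from the level-0 word-oscillation `c₀` (FILE 2∕(R-3): `η²·B₁(α₀+α₁)` at the representative) to C₇b's
# covariant oscillation letter `hOSC` AT EVERY LEVEL `i < r` of the S2β tower, with `O (i+1) y′ = 2·(d·3L)·c_i` and the one-step law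
# `c_{i+1} ≥ 3W(W+1+L)·c_i + 4θ_{i+1}·(3ℓ·M_i) + 2·ε_{i+1}` (architect px17 g23 01:09:54Z shape (a)(b)(c); desk №705 (4))

Cell `ym3-torus` (YM ladder rung R3 = continuum `SU(2)` Yang–Mills on the three-torus at fixed lattice data — a RUNG: NOT d = 4, NOT infinite volume, NOT a mass gap,
NOT Clay).  Width seat `ym3-torus-px13` (gen 29); crux `stmt-QuantumFields-20520`, LINE g18-1 S2β, node (REG-UP).  `--kind proof --supports stmt-QuantumFields-20520 --as helper`,
count-neutral, DEFINITION-FREE (0 `def`, 0 `instance`, 0 `notation`, 0 `sorry`, default heartbeats).  Generic `P : Params`, `SU(N)`.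

THE TOWER'S LETTERS (all HYPOTHESES, displayed): backgrounds `U i` with `U (i+1) = avgFun ℰ (U i)` (`hU`, as in C₇b), matrix data `F i : PBond P i → M_N(ℂ)` (the consumer sets
`F i b := ↑(X i b)`), the LINEARISATION ERROR `‖F (i+1) c̄ − (Q₁^{R₀}(U i) (F i))(c̄)‖ ≤ ε (i+1)` (`hE` — inhabited downstream by ✓(D1) `‖Dψ(0) − Q₁^{R₀}‖ ≤ 404ℓα` on `‖X‖` plus
the second-order remainder `R` of M-1‴∕C₆∕C₇; NOT here), sizes `‖F i b‖ ≤ M i` (`hM`), loop guards `dist1 (loopHol (U i) c̄ ι) ≤ θ (i+1) ≤ 1∕6`, `< δ_N` (`hθ`), the level-0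
word-oscillation `c₀ ≤ cs 0` (`h0`) and a NONDECREASING-ENOUGH constant sequence `cs` with `3W(W+1+L)·cs i + 4θ(i+1)·(3ℓ·M i) + 2ε(i+1) ≤ cs (i+1)` (`hcs`), `0 ≤ cs i`.

WHAT IS PROVED (sorry-free).
§1 THE BRIDGE torus ⟶ `ℤᵈ`: `walkEnd_transl`, `coe_hol_pull_eq`, `coe_inv_hol_pull_eq_star`, ★`zdWordOsc_of_torusWordOsc` — the torus word-oscillation hypothesis of FILE A1 gives
   ✓p839541 §3's `ℤᵈ` hypothesis `hosc` VERBATIM (`conjR (hol (pull (unitsField (toUField U₀)) 0) x w) (pull F 0 (x + disp w) κ) − pull F 0 x κ`).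
§2 ★`wordOsc_succ_of_linError` — ONE LEVEL: fine word-oscillation `c` of `F i` (w.r.t. `U i`) + `hE`, `hM`, `hθ` ⟹ coarse word-oscillation `3W(W+1+L)·c + 4θ·(3ℓM) + 2ε` of
   `F (i+1)` (w.r.t. `avgFun ℰ (U i)`) — FILE A2 ✓`covLinAvgR0_step_le` + the two `ε`'s + FILE A1 ✓`wordOsc_of_step`.
§3 ★★`wordOsc_tower` — induction: `∀ i ≤ r`, word-oscillation of `F i` w.r.t. `U i` `≤ |w|·cs i`.
§4 ★★★`hOSC_tower` — C₇b ✓p838589 `rows_K5_cov_osc`'s binder `hOSC` VERBATIM (for `↑(X i b)`), at EVERY `i < r`, with `O := fun i _ => 2·(d·(3L))·cs (i − 1)` read at `(i+1, y′)`: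
   `O (i+1) y′ = 2·(d·3L)·cs i` (✓p839541 `hOSC_of_wordOscillation` ∘ §1 ∘ §3).

HONEST.  Bookkeeping over FILE A1∕A2, ✓p839541 and the lit averaging letters; every estimate input (`ε`, `M`, `θ`, `c₀`, `cs`) is a displayed HYPOTHESIS; the size of `cs i`
(`≈ (C d²L²)^i·c₀ +` BKG×size `+` remainders — one scale factor per level in scale-free units, (F1)) is the CONSUMER's arithmetic; nothing of Bałaban's analysis is proved
([Balaban1985Averaging] Prop. 3∕4 are the printed loci); (RES-u), (L2-TOWER), the inhabitation of `ε`, GAP♯∘ (registry 3732b7df UNTOUCHED, 0∕5), the five registered stubs, S2β, crux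
20520, 19936, 19200, `YM3TorusSU2` — NOT proved; rung R3 — NOT d = 4, NOT infinite volume, NOT a mass gap, NOT Clay; the Yang–Mills mass gap is NOT proved.  Axioms standard.
-/

set_option autoImplicit false

noncomputable section

open scoped Matrix.Norms.L2Operator

namespace Summit.QuantumFields.YangMills.Theorems.FluctuationComparisonRegPrIntLS2BetaCovariantOscillationTower

open Literature.MathematicalPhysics.QuantumFieldTheory.Balaban1983to89
open T4Continuum (walk walkEnd holAt LStep holAt_nil holAt_cons Letter walk_append walkEnd_append holAt_append)
open BlockAveraging (Idx off avgFun loopHol)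
open ExpMeanLog (expMeanLogSU deltaSU)
open HaarExponentialChart
open B7Prop1Explicit (e hol disp disp_cons disp_nil)
open B7Eq78Linearization (conjR conjR_apply)
open B10Eq27TorusAxialLog (pull transl toUField unitsField holT hol_pull holT_map holT_toUField holT_eq_holAt val_suIncl transl_add_e transl_sub_e)
open T4AxialGaugeSmallField (axialGauge)
open BlockAveragingEMLLinearisedBackground (covLinAvgR0)
open Summit.QuantumFields.YangMills.Theorems.FluctuationComparisonRegPrIntLS2BetaCovWalkSumStokes (norm_coe_conj_le)
open Summit.QuantumFields.YangMills.Theorems.FluctuationComparisonRegPrIntLS2BetaCovariantOscillationWalkSums (wordOsc_of_step coe_inv_eq_star')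
open Summit.QuantumFields.YangMills.Theorems.FluctuationComparisonRegPrIntLS2BetaCovariantOscillationLinAvgStep (covLinAvgR0_step_le)
open Summit.QuantumFields.YangMills.Theorems.FluctuationComparisonRegPrIntLS2BetaCovariantOscillationCornerBox (hOSC_of_wordOscillation)

variable {P : Params} {j N : ℕ} [NeZero N]

/-! ## §1 The bridge: torus word-oscillation ⟹ the `ℤᵈ`-pullback hypothesis of ✓p839541 §3 -/

section Bridge

omit [NeZero N] in
/-- `walkEnd (y + z) w = y + (z + disp w)`. [folklore] -/
theorem walkEnd_transl (y : Site P j) : ∀ (z : B7Prop1Explicit.Site P.d) (w : List (Letter P.d)), walkEnd (transl y z) w = transl y (z + disp w)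
  | z, [] => by simp [walkEnd]
  | z, (μ, true) :: w => by
    rw [disp_cons, B7Prop1Explicit.Letter.vec_true, ← add_assoc, ← walkEnd_transl y (z + e μ) w, transl_add_e]; rfl
  | z, (μ, false) :: w => by
    rw [disp_cons, B7Prop1Explicit.Letter.vec_false, ← add_assoc, ← sub_eq_add_neg, ← walkEnd_transl y (z - e μ) w, transl_sub_e]; rfl

/-- The units-reading transport IS the `SU(N)` transport, as a matrix. [cite: Balaban1985Averaging, (9) p.18, (19) p.21] -/
theorem coe_hol_pull_eq (U₀ : GaugeField P j (Matrix.specialUnitaryGroup (Fin N) ℂ)) (z : B7Prop1Explicit.Site P.d) (w : List (Letter P.d)) :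
    ((hol (pull (unitsField (toUField U₀)) 0) z w : (Matrix (Fin N) (Fin N) ℂ)ˣ) : Matrix (Fin N) (Fin N) ℂ) =
      ((holAt U₀ (walk (transl 0 z) w) : Matrix.specialUnitaryGroup (Fin N) ℂ) : Matrix (Fin N) (Fin N) ℂ) := by
  rw [hol_pull, B10Eq27TorusAxialLog.val_holT_unitsField, holT_toUField, val_suIncl, holT_eq_holAt]

/-- … and its inverse is the conjugate transpose. [cite: Balaban1985Averaging, (9) p.18, (19) p.21] -/
theorem coe_inv_hol_pull_eq_star (U₀ : GaugeField P j (Matrix.specialUnitaryGroup (Fin N) ℂ)) (z : B7Prop1Explicit.Site P.d) (w : List (Letter P.d)) :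
    (((hol (pull (unitsField (toUField U₀)) 0) z w)⁻¹ : (Matrix (Fin N) (Fin N) ℂ)ˣ) : Matrix (Fin N) (Fin N) ℂ) =
      star ((holAt U₀ (walk (transl 0 z) w) : Matrix.specialUnitaryGroup (Fin N) ℂ) : Matrix (Fin N) (Fin N) ℂ) := by
  have hφ : unitsField (toUField U₀) = fun b => (Unitary.toUnits : Matrix.unitaryGroup (Fin N) ℂ →* (Matrix (Fin N) (Fin N) ℂ)ˣ) (toUField U₀ b) := rfl
  have h : hol (pull (unitsField (toUField U₀)) 0) z w =
      (Unitary.toUnits : Matrix.unitaryGroup (Fin N) ℂ →* (Matrix (Fin N) (Fin N) ℂ)ˣ) (holT (toUField U₀) (transl 0 z) w) := by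
    rw [hol_pull, hφ, holT_map]
  rw [h, ← map_inv, Unitary.val_toUnits_apply, Matrix.UnitaryGroup.inv_val, Matrix.star_eq_conjTranspose, holT_toUField, holT_eq_holAt]
  rfl

/-- ★ **TORUS WORD-OSCILLATION ⟹ THE `ℤᵈ` HYPOTHESIS OF ✓p839541 §3**, VERBATIM. [cite: Balaban1985Averaging, (8)-(9) p.18] -/
theorem zdWordOsc_of_torusWordOsc (U₀ : GaugeField P j (Matrix.specialUnitaryGroup (Fin N) ℂ)) (F : PBond P j → Matrix (Fin N) (Fin N) ℂ) {c : ℝ}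
    (hw : ∀ (x : Site P j) (w : List (Letter P.d)) (κ : Fin P.d),
      ‖((holAt U₀ (walk x w) : Matrix.specialUnitaryGroup (Fin N) ℂ) : Matrix (Fin N) (Fin N) ℂ) * F ⟨walkEnd x w, κ⟩ *
          star ((holAt U₀ (walk x w) : Matrix.specialUnitaryGroup (Fin N) ℂ) : Matrix (Fin N) (Fin N) ℂ) - F ⟨x, κ⟩‖ ≤ (w.length : ℝ) * c)
    (κ : Fin P.d) (x : B7Prop1Explicit.Site P.d) (w : List (Letter P.d)) :
    ‖conjR (hol (pull (unitsField (toUField U₀)) 0) x w) (pull F 0 (x + disp w) κ) - pull F 0 x κ‖ ≤ (w.length : ℝ) * c := by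
  have h := hw (transl 0 x) w κ
  rw [walkEnd_transl] at h
  rw [conjR_apply, coe_hol_pull_eq, coe_inv_hol_pull_eq_star, B10Eq27TorusAxialLog.pull_apply, B10Eq27TorusAxialLog.pull_apply]
  exact h

end Bridge

/-! ## §2 One level: the linearisation error enters twice -/

section OneLevel

/-- ★ **ONE LEVEL OF THE TOWER**: background `U₀` at level `j` (loop guard `θ`), fine datum `F` with word-oscillation `c` and size `M`, coarse datum `F′` with
`‖F′ c̄ − (Q₁^{R₀}(U₀)F)(c̄)‖ ≤ ε` ⟹ `F′` has word-oscillation `3W(W+1+L)·c + 4θ·(3ℓM) + 2ε` w.r.t. the averaged background `Ū₀ = avgFun ℰ U₀`.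
[cite: Balaban1985Averaging, (124)-(125) p.36, Prop. 4 (128)-(131) pp.37-38; Balaban1987RG1, (0.4) p.253] -/
theorem wordOsc_succ_of_linError (U₀ : GaugeField P j (Matrix.specialUnitaryGroup (Fin N) ℂ)) (F : PBond P j → Matrix (Fin N) (Fin N) ℂ)
    (F' : PBond P (j + 1) → Matrix (Fin N) (Fin N) ℂ) {c M θ ε : ℝ} (hc : 0 ≤ c) (hM : ∀ b, ‖F b‖ ≤ M)
    (hθ : ∀ (c' : PBond P (j + 1)) (i : Idx P), dist1 (loopHol U₀ c' i) ≤ θ) (hθδ : θ < deltaSU (Fin N)) (hθ6 : θ ≤ 1 / 6)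
    (hE : ∀ c' : PBond P (j + 1), ‖F' c' - covLinAvgR0 U₀ F c'‖ ≤ ε)
    (hw : ∀ (x : Site P j) (w : List (Letter P.d)) (κ : Fin P.d),
      ‖((holAt U₀ (walk x w) : Matrix.specialUnitaryGroup (Fin N) ℂ) : Matrix (Fin N) (Fin N) ℂ) * F ⟨walkEnd x w, κ⟩ *
          star ((holAt U₀ (walk x w) : Matrix.specialUnitaryGroup (Fin N) ℂ) : Matrix (Fin N) (Fin N) ℂ) - F ⟨x, κ⟩‖ ≤ (w.length : ℝ) * c)
    (ybar : Site P (j + 1)) (wbar : List (Letter P.d)) (κ : Fin P.d) :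
    ‖((holAt (avgFun (expMeanLogSU (n := Fin N)) U₀) (walk ybar wbar) : Matrix.specialUnitaryGroup (Fin N) ℂ) : Matrix (Fin N) (Fin N) ℂ) * F' ⟨walkEnd ybar wbar, κ⟩ *
        star ((holAt (avgFun (expMeanLogSU (n := Fin N)) U₀) (walk ybar wbar) : Matrix.specialUnitaryGroup (Fin N) ℂ) : Matrix (Fin N) (Fin N) ℂ) - F' ⟨ybar, κ⟩‖ ≤
      (wbar.length : ℝ) * (3 * ((3 * (P.d * ((P.L - 1) / 2)) + P.L : ℕ) : ℝ) * (((3 * (P.d * ((P.L - 1) / 2)) + P.L : ℕ) : ℝ) + 1 + P.L) * c +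
        4 * θ * (3 * ((((P.d + 2) * P.L : ℕ) : ℝ) * M)) + 2 * ε) := by
  refine wordOsc_of_step (avgFun (expMeanLogSU (n := Fin N)) U₀) F' (fun y μ κ' => ?_) ybar wbar κ
  set g : Matrix.specialUnitaryGroup (Fin N) ℂ := avgFun (expMeanLogSU (n := Fin N)) U₀ ⟨y, μ⟩ with hg
  have hstep := covLinAvgR0_step_le U₀ F hc hM hθ hθδ hθ6 hw y μ κ'
  rw [← hg] at hstep
  have e : (g : Matrix (Fin N) (Fin N) ℂ) * F' ⟨y.shift μ, κ'⟩ * star (g : Matrix (Fin N) (Fin N) ℂ) - F' ⟨y, κ'⟩ =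
      (g : Matrix (Fin N) (Fin N) ℂ) * (F' ⟨y.shift μ, κ'⟩ - covLinAvgR0 U₀ F ⟨y.shift μ, κ'⟩) * star (g : Matrix (Fin N) (Fin N) ℂ) +
        ((g : Matrix (Fin N) (Fin N) ℂ) * covLinAvgR0 U₀ F ⟨y.shift μ, κ'⟩ * star (g : Matrix (Fin N) (Fin N) ℂ) - covLinAvgR0 U₀ F ⟨y, κ'⟩) -
        (F' ⟨y, κ'⟩ - covLinAvgR0 U₀ F ⟨y, κ'⟩) := by noncomm_ring
  rw [e]
  refine (norm_sub_le _ _).trans ?_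
  refine (add_le_add ((norm_add_le _ _).trans (add_le_add ((norm_coe_conj_le g _).trans (hE _)) hstep)) (hE _)).trans ?_
  linarith

end OneLevel

/-! ## §3 ★★ The tower of word-oscillations -/

section Tower

/-- ★★ **THE TOWER OF WORD-OSCILLATIONS**: `U (i+1) = avgFun ℰ (U i)`, linearisation errors `ε`, sizes `M`, loop guards `θ`, level-0 constant `cs 0` and the one-step law
`3W(W+1+L)·cs i + 4θ(i+1)·(3ℓ·M i) + 2ε(i+1) ≤ cs (i+1)` ⟹ at every level `i ≤ r` the datum `F i` has word-oscillation `cs i` w.r.t. `U i`.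
[cite: Balaban1985Averaging, Prop. 4 (128)-(135) pp.37-38; Balaban1987RG1, (0.4) p.253] -/
theorem wordOsc_tower (r : ℕ) (U : (i : ℕ) → GaugeField P i (Matrix.specialUnitaryGroup (Fin N) ℂ)) (F : (i : ℕ) → PBond P i → Matrix (Fin N) (Fin N) ℂ)
    (hU : ∀ i, i < r → U (i + 1) = avgFun (expMeanLogSU (n := Fin N)) (U i))
    (ε M θ cs : ℕ → ℝ) (hcs0 : ∀ i, i ≤ r → 0 ≤ cs i)
    (hM : ∀ i, i < r → ∀ b, ‖F i b‖ ≤ M i)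
    (hθ : ∀ i, i < r → ∀ (c' : PBond P (i + 1)) (ι : Idx P), dist1 (loopHol (U i) c' ι) ≤ θ (i + 1))
    (hθδ : ∀ i, i < r → θ (i + 1) < deltaSU (Fin N)) (hθ6 : ∀ i, i < r → θ (i + 1) ≤ 1 / 6)
    (hE : ∀ i, i < r → ∀ c' : PBond P (i + 1), ‖F (i + 1) c' - covLinAvgR0 (U i) (F i) c'‖ ≤ ε (i + 1))
    (hcs : ∀ i, i < r → 3 * ((3 * (P.d * ((P.L - 1) / 2)) + P.L : ℕ) : ℝ) * (((3 * (P.d * ((P.L - 1) / 2)) + P.L : ℕ) : ℝ) + 1 + P.L) * cs i +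
        4 * θ (i + 1) * (3 * ((((P.d + 2) * P.L : ℕ) : ℝ) * M i)) + 2 * ε (i + 1) ≤ cs (i + 1))
    (h0 : ∀ (x : Site P 0) (w : List (Letter P.d)) (κ : Fin P.d),
      ‖((holAt (U 0) (walk x w) : Matrix.specialUnitaryGroup (Fin N) ℂ) : Matrix (Fin N) (Fin N) ℂ) * F 0 ⟨walkEnd x w, κ⟩ *
          star ((holAt (U 0) (walk x w) : Matrix.specialUnitaryGroup (Fin N) ℂ) : Matrix (Fin N) (Fin N) ℂ) - F 0 ⟨x, κ⟩‖ ≤ (w.length : ℝ) * cs 0) :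
    ∀ i, i ≤ r → ∀ (x : Site P i) (w : List (Letter P.d)) (κ : Fin P.d),
      ‖((holAt (U i) (walk x w) : Matrix.specialUnitaryGroup (Fin N) ℂ) : Matrix (Fin N) (Fin N) ℂ) * F i ⟨walkEnd x w, κ⟩ *
          star ((holAt (U i) (walk x w) : Matrix.specialUnitaryGroup (Fin N) ℂ) : Matrix (Fin N) (Fin N) ℂ) - F i ⟨x, κ⟩‖ ≤ (w.length : ℝ) * cs i := by
  intro i
  induction i with
  | zero => intro _ x w κ; exact h0 x w κ
  | succ i ih =>
    intro hi x w κ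
    have hi' : i < r := by omega
    have hrec := ih (by omega)
    have h := wordOsc_succ_of_linError (U i) (F i) (F (i + 1)) (hcs0 i (by omega)) (hM i hi') (hθ i hi') (hθδ i hi') (hθ6 i hi') (hE i hi') hrec x w κ
    rw [← hU i hi'] at h
    refine h.trans (mul_le_mul_of_nonneg_left (hcs i hi') (Nat.cast_nonneg _))

end Tower

/-! ## §4 ★★★ C₇b's `hOSC` at every level -/

section HOSC

/-- ★★★ **(REG-UP) DELIVERED IN C₇b's CURRENCY**: under the tower letters of §3 (with `F i b := ↑(X i b)`) and `r + 1 ≤ m + K`, the covariant oscillation letter `hOSC` of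
✓p838589 `rows_K5_cov_osc` holds at EVERY level `i < r` with `O (i+1) y′ := 2·(d·(3L))·cs i` — i.e. with `O := fun i _ => 2·(d·(3L))·cs (i − 1)`.  The level-0 input `cs 0` is
(R-3)'s `η²·B₁(α₀+α₁)` at the Thm-2 representative (✓p839541 §4, after (RES-u)); the growth of `cs` is the consumer's arithmetic.
[cite: Balaban1985Averaging, (8)-(9) p.18, (22) p.21, pp.24-25, Prop. 4 (128)-(135) pp.37-38; Balaban1987RG1, (0.3)-(0.4) pp.252-253] -/
theorem hOSC_tower (r : ℕ) (hr2 : r + 1 ≤ P.m + P.K) (U : (i : ℕ) → GaugeField P i (Matrix.specialUnitaryGroup (Fin N) ℂ))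
    (X : (i : ℕ) → PBond P i → (specialUnitaryLogChart (Fin N)).lie)
    (hU : ∀ i, i < r → U (i + 1) = avgFun (expMeanLogSU (n := Fin N)) (U i))
    (ε M θ cs : ℕ → ℝ) (hcs0 : ∀ i, i ≤ r → 0 ≤ cs i)
    (hM : ∀ i, i < r → ∀ b, ‖((X i b : (specialUnitaryLogChart (Fin N)).lie) : Matrix (Fin N) (Fin N) ℂ)‖ ≤ M i)
    (hθ : ∀ i, i < r → ∀ (c' : PBond P (i + 1)) (ι : Idx P), dist1 (loopHol (U i) c' ι) ≤ θ (i + 1))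
    (hθδ : ∀ i, i < r → θ (i + 1) < deltaSU (Fin N)) (hθ6 : ∀ i, i < r → θ (i + 1) ≤ 1 / 6)
    (hE : ∀ i, i < r → ∀ c' : PBond P (i + 1),
      ‖((X (i + 1) c' : (specialUnitaryLogChart (Fin N)).lie) : Matrix (Fin N) (Fin N) ℂ) -
          covLinAvgR0 (U i) (fun b => ((X i b : (specialUnitaryLogChart (Fin N)).lie) : Matrix (Fin N) (Fin N) ℂ)) c'‖ ≤ ε (i + 1))
    (hcs : ∀ i, i < r → 3 * ((3 * (P.d * ((P.L - 1) / 2)) + P.L : ℕ) : ℝ) * (((3 * (P.d * ((P.L - 1) / 2)) + P.L : ℕ) : ℝ) + 1 + P.L) * cs i +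
        4 * θ (i + 1) * (3 * ((((P.d + 2) * P.L : ℕ) : ℝ) * M i)) + 2 * ε (i + 1) ≤ cs (i + 1))
    (h0 : ∀ (x : Site P 0) (w : List (Letter P.d)) (κ : Fin P.d),
      ‖((holAt (U 0) (walk x w) : Matrix.specialUnitaryGroup (Fin N) ℂ) : Matrix (Fin N) (Fin N) ℂ) * ((X 0 ⟨walkEnd x w, κ⟩ : (specialUnitaryLogChart (Fin N)).lie) : Matrix (Fin N) (Fin N) ℂ) *
          star ((holAt (U 0) (walk x w) : Matrix.specialUnitaryGroup (Fin N) ℂ) : Matrix (Fin N) (Fin N) ℂ) - ((X 0 ⟨x, κ⟩ : (specialUnitaryLogChart (Fin N)).lie) : Matrix (Fin N) (Fin N) ℂ)‖ ≤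
        (w.length : ℝ) * cs 0)
    {μ ν : Fin P.d} :
    ∀ i, i < r → ∀ (y' : Site P (i + 1)) (b b' : PBond P i), (blockOf b.src = y' ∨ blockOf b.src = y'.shift μ ∨ blockOf b.src = y'.shift ν ∨ blockOf b.src = (y'.shift μ).shift ν) →
      (blockOf b'.src = y' ∨ blockOf b'.src = y'.shift μ ∨ blockOf b'.src = y'.shift ν ∨ blockOf b'.src = (y'.shift μ).shift ν) → b.dir = b'.dir →
      ‖(((axialGauge (U i) (fun κ : Fin P.d => (((emb y' κ).val : ℕ) : ℤ) - (((P.L - 1) / 2 : ℕ) : ℤ)) (fun κ : Fin P.d => (((emb y' κ).val : ℕ) : ℤ) + (((if κ = μ then (P.L : ℤ) else 0) + (if κ = ν then (P.L : ℤ) else 0)) + (((P.L - 1) / 2 : ℕ) : ℤ)) + 1)) b.src : Matrix.specialUnitaryGroup (Fin N) ℂ) : Matrix (Fin N) (Fin N) ℂ) * ((X i b : (specialUnitaryLogChart (Fin N)).lie) : Matrix (Fin N) (Fin N) ℂ) * star (((axialGauge (U i) (fun κ : Fin P.d => (((emb y' κ).val : ℕ) : ℤ) - (((P.L - 1) / 2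 : ℕ) : ℤ)) (fun κ : Fin P.d => (((emb y' κ).val : ℕ) : ℤ) + (((if κ = μ then (P.L : ℤ) else 0) + (if κ = ν then (P.L : ℤ) else 0)) + (((P.L - 1) / 2 : ℕ) : ℤ)) + 1)) b.src : Matrix.specialUnitaryGroup (Fin N) ℂ) : Matrix (Fin N) (Fin N) ℂ) -
        (((axialGauge (U i) (fun κ : Fin P.d => (((emb y' κ).val : ℕ) : ℤ) - (((P.L - 1) / 2 : ℕ) : ℤ)) (fun κ : Fin P.d => (((emb y' κ).val : ℕ) : ℤ) + (((if κ = μ then (P.L : ℤ) else 0) + (if κ = ν then (P.L : ℤ) else 0)) + (((P.L - 1) / 2 : ℕ) : ℤ)) + 1)) b'.src : Matrix.specialUnitaryGroup (Fin N) ℂ) : Matrix (Fin N) (Fin N) ℂ) * ((X i b' : (specialUnitaryLogChart (Fin N)).lie) : Matrix (Fin N) (Fin N) ℂ) * star (((axialGauge (U i) (fun κ : Fin P.d => (((emb y' κ).val : ℕ) : ℤ) - (((P.L - 1) / 2 : ℕ) : ℤ)) (fun κ : Fin P.d => (((emb y' κ).val : ℕ) : ℤ) + (((if κ = μ then (P.L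 : ℤ) else 0) + (if κ = ν then (P.L : ℤ) else 0)) + (((P.L - 1) / 2 : ℕ) : ℤ)) + 1)) b'.src : Matrix.specialUnitaryGroup (Fin N) ℂ) : Matrix (Fin N) (Fin N) ℂ)‖ ≤
      (fun (i : ℕ) (_ : Site P i) => 2 * ((P.d : ℝ) * ((3 * P.L : ℕ) : ℝ)) * cs (i - 1)) (i + 1) y' := by
  intro i hi y' b b' hb hb' hdir
  have htow := wordOsc_tower r U (fun i b => ((X i b : (specialUnitaryLogChart (Fin N)).lie) : Matrix (Fin N) (Fin N) ℂ)) hU ε M θ cs hcs0 hM hθ hθδ hθ6 hE hcs h0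
    i (by omega)
  have hz := zdWordOsc_of_torusWordOsc (U i) (fun b => ((X i b : (specialUnitaryLogChart (Fin N)).lie) : Matrix (Fin N) (Fin N) ℂ)) htow
  show _ ≤ 2 * ((P.d : ℝ) * ((3 * P.L : ℕ) : ℝ)) * cs (i + 1 - 1)
  rw [Nat.add_sub_cancel]
  exact hOSC_of_wordOscillation (by omega) (by omega) (U i) (fun b => ((X i b : (specialUnitaryLogChart (Fin N)).lie) : Matrix (Fin N) (Fin N) ℂ)) (hcs0 i (by omega)) hz
    y' b b' hb hb' hdir

end HOSC

end Summit.QuantumFields.YangMills.Theorems.FluctuationComparisonRegPrIntLS2BetaCovariantOscillationTower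

end
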